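import Literature.AlgebraicGeometry.Resolution.Temkin2008OfHironaka
import Literature.AlgebraicGeometry.Resolution.GeneralLUProofs
import HarnessLib

/-!
# `Hironaka1964_local` is equivalent to the local desingularization problem of Temkin 2008, §3.4

Topic: `Literature/AlgebraicGeometry/Resolution`. Companion of `Temkin2008Localization.lean` and
`Temkin2008OfHironaka.lean` (proofs only: no new notions, no new named facts). The named fact
`Hironaka1964_local` (Hironaka 1964, Main Theorem I, in the generality recorded by Temkin 2008,
p. 3: resolution of singularities over every local quasi-excellent ring of residue
characteristic zero) is the single leaf under `Temkin2008`, `Hironaka1964` and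
`CossartPiltant2019LUCompleteChar0`. Temkin's second, Hironaka-free proof of this statement
(Thm. 3.4.3, p. 19: "by proposition 2.3.4, it suffices to prove that if `S` is an integral local
`k`-scheme of essentially finite type, `s ∈ S` is a closed point, and `f : S' → S` is a blow up
with `S'_sing ⊂ f⁻¹(s)`, then `S'` admits a desingularization … by the previous corollary
[Cor. 3.4.2: rig-regular formal schemes and algebraization]") starts with a reduction to a LOCAL
DESINGULARIZATION PROBLEM. This file proves, sorry-free, that over local bases the reduction is an
equivalence, so that any future formalization of Temkin's §3 (or of Hironaka's Main Theorem I)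
docks at exactly one statement:

  (L) for every local quasi-excellent domain `S` whose residue field has characteristic zero,
      every blow-up `g : S' → Spec S` along a nonzero ideal whose non-regular points lie over
      the closed point admits a desingularization (an `S'_reg`-admissible blow-up with regular
      source, Temkin Def. 2.2.6).

* `Hironaka1964_local.admitsDesingularization_of_isBlowup_local` — `Hironaka1964_local → (L)`
  (a blow-up of `Spec S` along a nonzero ideal is integral and proper, in particular of finite
  type, over `S`);
* `hironaka1964_local_of_isBlowup_local` — `(L) → Hironaka1964_local`: for `X` integral of finite
  type over `Spec A`, Prop. 2.3.4 for the single scheme `X` (`admitsDesingularization_of_local`,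
  PROVED in `Temkin2008OfHironaka.lean`) needs desingularizations of the blow-ups of
  `Spec 𝒪_{X,x}` with singularities over the closed point only; `𝒪_{X,x}` is a local
  quasi-excellent domain (`Stacks07QU_holds`, `Stacks07QU_localization_holds`, both PROVED) with
  residue field of characteristic zero (`charZero_residueField_stalk`), so (L) applies — the
  blow-up along the zero ideal being empty;
* `hironaka1964_local_iff_isBlowup_local` — the equivalence;
* `isBlowup_local_standing_hypotheses` (with `charZero_residueField_of_over_local`) — the schemes
  `S'` of (L) are integral, Noetherian, quasi-excellent, with residue fields of characteristic
  zero: the standing hypotheses of Temkin's Cor. 3.4.2, where a proof of (L) would start.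

No named fact is introduced: (L) appears only as a hypothesis/conclusion of proved theorems.

## Sources

* M. Temkin, *Desingularization of quasi-excellent schemes in characteristic zero*, Adv. Math.
  219 (2008) 488–522 = arXiv:math/0703678 (arXiv pagination): Prop. 2.3.4 and its proof (p. 12),
  Thm. 2.3.6 (p. 13), proof of Thm. 3.4.3 (p. 19). [Temkin2008]
* H. Hironaka, *Resolution of singularities of an algebraic variety over a field of
  characteristic zero I*, Ann. of Math. 79 (1964) 109–203, Main Theorem I. [Hironaka1964]
* The Stacks Project, Tag 07QU. [StacksProject]
-/

noncomputable section

open CategoryTheory AlgebraicGeometry TopologicalSpace IsLocalRing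

namespace Literature.AlgebraicGeometry.Resolution

universe u

/-- **`Hironaka1964_local` solves the local desingularization problem (L)** (Temkin 2008, proof
of Thm. 2.3.6, p. 13): a blow-up `S'` of `Spec S` (`S` a local quasi-excellent domain with residue
field of characteristic zero) along a nonzero ideal is integral (`IsBlowup.isIntegral`) and
proper (`IsBlowup.isProper`) — in particular of finite type — over `S`, so Hironaka's theorem
over the local ring `S` desingularizes it; along the zero ideal `S' = ∅` is regular.
[cite: Temkin2008, Thm. 2.3.6 (proof, p. 13)] [cite: Hironaka1964, Main Theorem I] -/
theorem Hironaka1964_local.admitsDesingularization_of_isBlowup_local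
    (hH : Hironaka1964_local.{u}) (S : Type u) [CommRing S] [IsLocalRing S] [IsDomain S]
    (hS : IsQuasiExcellentRing S) (h0 : CharZero (ResidueField S)) {S' : Scheme.{u}}
    {g : S' ⟶ Spec (.of S)} {I : (Spec (.of S)).IdealSheafData} (hg : IsBlowup g I) :
    Scheme.AdmitsDesingularization S' := by
  by_cases hI : I = ⊥
  · subst hI
    haveI := hg.isEmpty_of_bot
    exact Scheme.admitsDesingularization_of_isEmpty S'
  haveI : IsNoetherianRing S := hS.isNoetherianRing
  haveI : IsNoetherianRing (CommRingCat.of S) := ‹IsNoetherianRing S›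
  haveI : IsDomain (CommRingCat.of S) := ‹IsDomain S›
  haveI : IsIntegral S' := hg.isIntegral hI
  haveI : IsProper g := hg.isProper
  exact hH S hS h0 S' g

/-- **The local desingularization problem (L) implies `Hironaka1964_local`** (Temkin 2008, proof
of Thm. 3.4.3, p. 19: "by proposition 2.3.4, it suffices to prove that if `S` is an integral
local `k`-scheme of essentially finite type, `s ∈ S` is a closed point, and `f : S' → S` is a
blow up with `S'_sing ⊂ f⁻¹(s)`, then `S'` admits a desingularization", over a local base
`k = Spec A`): let `A` be a local quasi-excellent ring with residue field of characteristic zero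
and `X` an integral `A`-scheme of finite type. By Prop. 2.3.4 for the single scheme `X`
(`admitsDesingularization_of_local`; `Spec A` is a Noetherian quasi-excellent scheme by
Stacks 07QU, `Stacks07QU_holds`) it suffices to desingularize the blow-ups `S'` of the local
schemes `S = Spec 𝒪_{X,x}` whose non-regular points lie over the closed point. Here `𝒪_{X,x}` is
a local domain (`X` is integral), quasi-excellent (`X` is quasi-excellent, being of finite type
over `A`, and so are its local rings: `Scheme.IsQuasiExcellent.isQuasiExcellentRing_stalk`, from
`Stacks07QU_localization_holds`), with residue field of characteristic zero
(`charZero_residueField_stalk`: the nonzero integers are units of `A`); so (L) applies when the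
centre is nonzero, and the blow-up along the zero ideal is empty, hence regular.
[cite: Temkin2008, Thm. 3.4.3 (proof, p. 19) and Prop. 2.3.4] -/
theorem hironaka1964_local_of_isBlowup_local
    (hL : ∀ (S : Type u) [CommRing S] [IsLocalRing S] [IsDomain S], IsQuasiExcellentRing S →
      CharZero (ResidueField S) →
      ∀ (S' : Scheme.{u}) (g : S' ⟶ Spec (.of S)) (I : (Spec (.of S)).IdealSheafData),
        IsBlowup g I → I ≠ ⊥ →
        (∀ s : S', s ∉ Scheme.regularLocus S' → g s = closedPoint S) →
        Scheme.AdmitsDesingularization S') :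
    Hironaka1964_local.{u} := by
  intro A _ _ hA h0 X f _ _ _
  haveI : IsNoetherianRing A := hA.isNoetherianRing
  haveI : IsNoetherianRing (CommRingCat.of A) := ‹IsNoetherianRing A›
  haveI : IsNoetherian (Spec (.of A)) := {}
  haveI : CharZero (ResidueField A) := h0
  -- `Spec A` and `X` are quasi-excellent schemes (Stacks 07QU)
  have hk : Scheme.IsQuasiExcellent (Spec (.of A)) :=
    Scheme.isQuasiExcellent_of_locallyOfFiniteType_of_isQuasiExcellentRing Stacks07QU_holds hA
      (𝟙 (Spec (.of A)))
  have hX : Scheme.IsQuasiExcellent X :=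
    Scheme.isQuasiExcellent_of_locallyOfFiniteType_of_isQuasiExcellentRing Stacks07QU_holds hA f
  -- the residue fields of `Spec A` have characteristic zero
  have h0' : ∀ y : Spec (.of A), CharZero ((Spec (.of A)).residueField y) :=
    charZero_residueField_spec fun n hn => isUnit_natCast_of_charZero_residueField (A := A) n hn
  -- Prop. 2.3.4 for the single scheme `X`: only blow-ups of the local schemes `Spec 𝒪_{X,x}` matter
  refine admitsDesingularization_of_local hk f fun x S' g I hg hsing => ?_
  by_cases hI : I = ⊥
  · subst hI
    haveI := hg.isEmpty_of_bot
    exact Scheme.admitsDesingularization_of_isEmpty S'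
  exact hL (X.presheaf.stalk x) (hX.isQuasiExcellentRing_stalk x)
    (charZero_residueField_stalk f h0' x) S' g I hg hI hsing

/-- **Residue fields over a local ring of residue characteristic zero have characteristic
zero**: for `f : X ⟶ Spec S` with `S` local and `char S/𝔪 = 0`, the nonzero integers are units
of `S` (`isUnit_natCast_of_charZero_residueField`), hence of every residue field `κ(x)` of `X`
(an `S`-algebra through `Γ(Spec S) → Γ(X) → κ(x)`). [folklore] -/
theorem charZero_residueField_of_over_local {S : Type u} [CommRing S] [IsLocalRing S]
    [CharZero (ResidueField S)] {X : Scheme.{u}} (f : X ⟶ Spec (.of S)) (x : X) :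
    CharZero (X.residueField x) := by
  let e : S ≃+* Γ(Spec (.of S), ⊤) := (Scheme.ΓSpecIso (.of S)).commRingCatIsoToRingEquiv.symm
  let φ : S →+* X.residueField x :=
    (X.evaluation ⊤ x trivial).hom.comp ((f.appTop).hom.comp e.toRingHom)
  exact charZero_of_ringHom_of_isUnit_natCast φ fun n hn =>
    isUnit_natCast_of_charZero_residueField (A := S) n hn

/-- **The schemes `S'` of the local desingularization problem (L) satisfy the standing
hypotheses of Temkin 2008, Cor. 3.4.2** ("Let `X` be an integral noetherian quasi-excellent
scheme of characteristic zero …"): a blow-up `S'` of `Spec S` — `S` a local quasi-excellent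
domain with residue field of characteristic zero — along a nonzero ideal is integral
(`IsBlowup.isIntegral`), Noetherian (proper, in particular of finite type, over the Noetherian
ring `S`), quasi-excellent (of finite type over a quasi-excellent ring, Stacks 07QU =
`Stacks07QU_holds`), and all its residue fields have characteristic zero
(`charZero_residueField_of_over_local`). (The remaining hypothesis of Cor. 3.4.2 — a closed
subscheme `Z ⊇ S'_sing` of finite type over a field — is, in the proof of Thm. 3.4.3, the reduced
singular locus, of finite type over the residue field `S/𝔪` because it lies over the closed
point.) [cite: Temkin2008, Cor. 3.4.2 and proof of Thm. 3.4.3 (p. 18–19)]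
[cite: StacksProject, Tag 07QU] -/
theorem isBlowup_local_standing_hypotheses (S : Type u) [CommRing S] [IsLocalRing S] [IsDomain S]
    (hS : IsQuasiExcellentRing S) (h0 : CharZero (ResidueField S)) {S' : Scheme.{u}}
    {g : S' ⟶ Spec (.of S)} {I : (Spec (.of S)).IdealSheafData} (hg : IsBlowup g I) (hI : I ≠ ⊥) :
    IsIntegral S' ∧ IsNoetherian S' ∧ Scheme.IsQuasiExcellent S' ∧
      ∀ y : S', CharZero (S'.residueField y) := by
  haveI : IsNoetherianRing S := hS.isNoetherianRing
  haveI : IsNoetherianRing (CommRingCat.of S) := ‹IsNoetherianRing S›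
  haveI : IsDomain (CommRingCat.of S) := ‹IsDomain S›
  haveI : CharZero (ResidueField S) := h0
  haveI : IsIntegral S' := hg.isIntegral hI
  haveI : IsProper g := hg.isProper
  haveI : IsLocallyNoetherian S' := LocallyOfFiniteType.isLocallyNoetherian g
  haveI : CompactSpace S' := QuasiCompact.compactSpace_of_compactSpace g
  exact ⟨‹IsIntegral S'›, {},
    Scheme.isQuasiExcellent_of_locallyOfFiniteType_of_isQuasiExcellentRing Stacks07QU_holds hS g,
    charZero_residueField_of_over_local g⟩

/-- **`Hironaka1964_local` ⟺ the local desingularization problem (L)**: resolution of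
singularities over every local quasi-excellent ring of residue characteristic zero (Hironaka
1964, Main Theorem I, as read by Temkin 2008) holds if and only if, for every local
quasi-excellent domain `S` with residue field of characteristic zero, every blow-up
`S' → Spec S` along a nonzero ideal whose non-regular points lie over the closed point admits a
desingularization — the statement to which Temkin's Thm. 3.4.3 reduces the theorem and which his
Cor. 3.4.2 (rig-regular formal schemes, algebraization) establishes.
[cite: Temkin2008, Thm. 3.4.3 (proof, p. 19), Thm. 2.3.6, Prop. 2.3.4]
[cite: Hironaka1964, Main Theorem I] -/
theorem hironaka1964_local_iff_isBlowup_local :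
    Hironaka1964_local.{u} ↔
      ∀ (S : Type u) [CommRing S] [IsLocalRing S] [IsDomain S], IsQuasiExcellentRing S →
        CharZero (ResidueField S) →
        ∀ (S' : Scheme.{u}) (g : S' ⟶ Spec (.of S)) (I : (Spec (.of S)).IdealSheafData),
          IsBlowup g I → I ≠ ⊥ →
          (∀ s : S', s ∉ Scheme.regularLocus S' → g s = closedPoint S) →
          Scheme.AdmitsDesingularization S' :=
  ⟨fun hH S _ _ _ hS h0 _S' _g _I hg _ _ => hH.admitsDesingularization_of_isBlowup_local S hS h0 hg,
    hironaka1964_local_of_isBlowup_local⟩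

end Literature.AlgebraicGeometry.Resolution

end
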